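import Mathlib
import Summits.ValiantsHypothesis.ValiantsHypothesis.Theorems.GirthSidonSparseSwallowForcesShortRelation

/-!
# Route GirthSidon — crux `MomentCurveElusive`, stub `stub_coveringGirth` (the girth engine)

Route `route-ValiantsHypothesis-GirthSidon`, item `stmt-ValiantsHypothesis-6534` (support for the
line TRANSFER → SMALL SUMSET COVER → GIRTH → VANDERMONDE of the birth skeleton).

If an injective exponent vector `D : Fin m → ℕ` is covered by a small sumset, `D i ∈ U + U` for all
`i` with `|U|^20 ≤ m^19` and `m ≥ 4098^25`, then `D` has a short additive relation: multisets
`S ≠ T` over `Fin m` of size `≤ 30` with `Σ_S D = Σ_T D`.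

Proof (verbatim the structure of Part E of
`Theorems/GirthSidonSparseSwallowForcesShortRelation.lean`, with its vertex set `V` replaced by the
given `U` and `s * B` by `|U|`).  Write `D i = u i + v i` with `u i, v i ∈ U`.  The loops
`u i = v i` are at most `|U|` many (injectivity of `D`), so the indices with `u i ≠ v i` form
`≥ m - |U|` distinct proper edges of a multigraph on the vertex set `U`.  Part D of that file
(`GirthSidonSparse.exists_t_of_pow_le`) supplies `t` with `|U| + 1 < t^30` and
`(2t + 61)(|U| + 1) < m`, whence `2 (t + 30) |U| < #edges` and `|U| < t^30`; Part B
(`GirthSidonSparse.exists_relation_core`: dense core + Moore path count with `k = 30`) gives the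
relation over `ℤ`, which is cast back to `ℕ`.
-/

-- Sub = Summit layout duplicates the namespace component
set_option linter.dupNamespace false

namespace Summit.ValiantsHypothesis.ValiantsHypothesis.Theorems

open GirthSidonSparse in
/-- **Stub `stub_coveringGirth` (the girth engine of crux `MomentCurveElusive`).** For
`m ≥ 4098^25`, an injective `D : Fin m → ℕ` with `D i ∈ U + U` for all `i`, where `U ⊂ ℤ` has
`|U|^20 ≤ m^19`, admits two distinct multisets `S ≠ T` of indices of size `≤ 30` with equal
`D`-sums.  Proof: loops `u i = v i` inject into `U` via `D`; the `≥ m - |U|` proper edges on the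
vertex set `U` exceed `2 (t + 30) |U|` for the `t` of `exists_t_of_pow_le`, and `|U| < t^30`, so
`exists_relation_core` (dense subgraph + Moore count, `k = 30`) applies. -/
theorem stub_coveringGirth :
    ∃ m₀ : ℕ, ∀ m ≥ m₀, ∀ (D : Fin m → ℕ), Function.Injective D →
      ∀ U : Finset ℤ, U.card ^ 20 ≤ m ^ 19 →
        (∀ i, ∃ a ∈ U, ∃ b ∈ U, (D i : ℤ) = a + b) →
        ∃ S T : Multiset (Fin m), S ≠ T ∧ Multiset.card S ≤ 30 ∧ Multiset.card T ≤ 30 ∧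
          (S.map D).sum = (T.map D).sum := by
  refine ⟨4098 ^ 25, fun m hm D hinj U hU hcov => ?_⟩
  classical
  choose u hu v hv huv using hcov
  -- proper edges `E` and loops `L`
  let E : Finset (Fin m) := Finset.univ.filter fun i => u i ≠ v i
  let L : Finset (Fin m) := Finset.univ.filter fun i => u i = v i
  have hLcard : L.card ≤ U.card := by
    refine Finset.card_le_card_of_injOn u (fun i _ => hu i) ?_
    intro i hi j hj hij
    simp only [L, Finset.coe_filter, Finset.mem_univ, true_and, Set.mem_setOf_eq] at hi hj
    apply hinj
    have h : (D i : ℤ) = D j := by rw [huv i, huv j, ← hi, ← hj, hij]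
    exact_mod_cast h
  have hELcard : E.card + L.card = m := by
    have h := Finset.card_filter_add_card_filter_not (s := (Finset.univ : Finset (Fin m)))
      (fun i : Fin m => u i ≠ v i)
    simp only [ne_eq, not_not, Finset.card_univ, Fintype.card_fin] at h
    exact h
  -- the arithmetic
  obtain ⟨t, ht1, ht2⟩ := exists_t_of_pow_le m U.card hm hU
  have hdinj : Function.Injective (fun i : Fin m => (D i : ℤ)) :=
    (Nat.cast_injective (R := ℤ)).comp hinj
  -- `2 (t + 30) |U| < |E|`
  have hδ : 2 * (t + 30) * U.card < E.card := by
    have hQ : (2 * t + 61) * (U.card + 1) = 2 * (t + 30) * (U.card + 1) + (U.card + 1) := by ring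
    have hX : 2 * (t + 30) * U.card ≤ 2 * (t + 30) * (U.card + 1) :=
      Nat.mul_le_mul_left _ (Nat.le_succ _)
    omega
  -- `|U| < t^30`
  have hk : U.card < (t + 30 - 30) ^ 30 := by
    rw [Nat.add_sub_cancel]
    omega
  obtain ⟨S, T, hST, hS, hT, hsumeq⟩ := exists_relation_core (fun i : Fin m => (D i : ℤ)) u v huv
    hdinj U E (fun i hi => ⟨hu i, hv i, by simpa [E] using hi⟩) (t + 30) 30 hδ hk
  refine ⟨S, T, hST, hS, hT, ?_⟩
  have h1 : (((S.map D).sum : ℕ) : ℤ) = (S.map fun i => (D i : ℤ)).sum := by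
    rw [Nat.cast_multiset_sum, Multiset.map_map]; rfl
  have h2 : (((T.map D).sum : ℕ) : ℤ) = (T.map fun i => (D i : ℤ)).sum := by
    rw [Nat.cast_multiset_sum, Multiset.map_map]; rfl
  have h : (((S.map D).sum : ℕ) : ℤ) = (T.map D).sum := by rw [h1, h2, hsumeq]
  exact_mod_cast h

end Summit.ValiantsHypothesis.ValiantsHypothesis.Theorems
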